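import Summits.BirchSwinnertonDyer.BirchSwinnertonDyer.Theorems.PrintCf2RamifiedOffTYZRankZeroDigit
import Literature.NumberTheory.EllipticCurves.Wang2016.SelmerRankTwoIffFourRankOne
import Literature.NumberTheory.EllipticCurves.ShaPrimaryIsogenyKill
import HarnessLib

/-!
# The census law (L1) of line `offtyz-v7` BY NAME: inside 𝔅_ram + Wang 2016, `2 ∥ 𝓛(l) ⟺ l = u² + 8v² (v odd)` for primes `l ≡ 1 (mod 8)`
# (crux stmt-BirchSwinnertonDyer-20509 `RamifiedOffTYZOfFacts`, LEAD cruxlead-20509 g25, cycle 26; `def`-free, no `sorry`)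

HONEST FRAMING (cell `bsd-print-cf2`, route `PrintCf2`; `--supports stmt-BirchSwinnertonDyer-20509`).  BSD is not proved by any of this; no
class is closed by this file; item 23431 (C⁺) and crux 20509 stay OPEN.

Sequel of `PrintCf2RamifiedOffTYZRankZeroDigit` (the rank-zero digit of TYZ's recursion is exact inside the bundle: for a prime `l ≡ 1 (mod 8)` with
`r_an(E_l) = 0`, `4 ∣ 𝓛(l) ⟺ #Sel₄(E_l) ≠ 2⁴`).  Here the remaining, purely Selmer-side half is taken FROM PRINT: Wang 2016 (Sci. China Math. 59),
Thm 3 at `k = 1` — for a prime `l ≡ 1 (mod 8)` (where `h₄(l) = 1` is automatic: Lemma 4 + Monsky's `s(l) = 2`), `δ_l = 1` (i.e. `l = u² + 8v²`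
with `v` odd, `Wang2016.IsDeltaOne l`) ⟺ `rank E_l(ℚ) = 0 ∧ Ш(E_l)[2^∞] ≃ (ℤ/2)²` — both vendored as named journal facts
(`Wang2016.thm3_rank_zero_and_sha_two_by_two`, `Wang2016.lem4_card_selmerGroup_two_eq_sixteen_iff_h4`).  Result:

* `isDeltaOne_iff_rank_zero_and_sha_of_wang` — Wang's Thm 3 at `k = 1`, K-free (field binder `sqrtField (−l)`, class-group binder by Lemma 4).
* ★★★ `not_four_dvd_scriptL_iff_isDeltaOne_of_facts` / `scriptL_prime_digit_of_bundle_of_wang` — granted conjuncts 2, 4 of 𝔅_ram and Wang's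
  Thm 3 + Lemma 4: for every prime `l ≡ 1 (mod 8)` with `r_an(E_l) = 0` and every `L` with `𝓛(l)² = L²`: `L ≠ 0`, `2 ∣ L`, and
  **`¬ 4 ∣ L ⟺ IsDeltaOne l`**.  Since a prime `l ≡ 1 (mod 8)` has a unique representation `l = x² + 8y²` up to signs,
  `¬ IsDeltaOne l ⟺ l = x² + 32y²`: this is the census law (L1) «`4 ∣ 𝓛(l) ⟺ l = x² + 32y²`» of `Lines/offtyz_v7_GenusPeriodBit.md` §9–§11
  (34/34 primes of the R2 census) on its `r_an(E_l) = 0` locus — the digit deciding `P(lq) ≡ Z(lq) (mod 4A(ℍ′_{lq}))` in TYZ's recursion on R2.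
  (Its `r_an(E_l) ≥ 2` locus, `𝓛(l) = 0`, is `RankZeroDigit.scriptL_eq_zero_of_two_le_analyticRank`; that `IsDeltaOne l ⟹ r_an(E_l) = 0` would
  need a rank-zero `2`-converse, Burungale–Tian, which is not in 𝔅_ram and is not used here.)

References: [cite: Wang2016CongruentSha, Thm. 3 (arXiv:1511.03810 p0011 L107–L131), Lemma 4 (p0010 L20–L22)]; [cite: TianYuanZhang2017, §1 (1.1), §3.1];
[cite: BurungaleFlach2024, Thm 1.1 / Cor. 3]; [cite: HeathBrown1994SelmerCongruentII, Appendix (Monsky)]; [cite: Lang2002, Ch. III §5] (`(ℤ/2)²` from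
order `4` and exponent `2`, tree `nonempty_addEquiv_prod_zmod_of_natCard_eq_sq`).  LEAD memo: `Lines/offtyz_v7_RankZeroDigit.md`.
-/

noncomputable section

open scoped Classical

open WeierstrassCurve Literature.NumberTheory.EllipticCurves Literature.NumberTheory.EllipticCurves.TianYuanZhang2017
  Literature.NumberTheory.EllipticCurves.HeathBrown1994 Literature.NumberTheory.EllipticCurves.Wang2016

set_option autoImplicit false

namespace Summit.BirchSwinnertonDyer.PrintCf2.RankZeroDigit

/-! ## §4 The census law (L1) BY NAME: inside 𝔅_ram + Wang 2016 (Thm 3, Lemma 4), `2 ∥ 𝓛(l) ⟺ l = u² + 8v², v odd` -/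

/-- For a prime `l`, Wang's `δ_l` is odd iff `δ_l = 1`, i.e. iff `l = u² + 8v²` with `v` odd (`IsDeltaOne l`).
[cite: Wang2016CongruentSha, Thm. 3 (i) (arXiv:1511.03810 p0011 L107–L127)] -/
theorem odd_deltaCount_iff_isDeltaOne {l : ℕ} (hl : l.Prime) : Odd (deltaCount l) ↔ IsDeltaOne l := by
  rw [deltaCount, Nat.Prime.primeFactors hl, Finset.filter_singleton]
  by_cases h : IsDeltaOne l
  · rw [if_pos h, Finset.card_singleton]; exact iff_of_true odd_one h
  · rw [if_neg h, Finset.card_empty]; exact iff_of_false (by decide) h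

/-- The prime factors of a prime `l ≡ 1 (mod 8)` are `≡ 1 (mod 8)` (and `≡ 1 (mod 4)`). [folklore] -/
theorem primeFactors_mod_of_prime {l : ℕ} (hl : l.Prime) (h8 : l % 8 = 1) :
    (∀ p ∈ l.primeFactors, p % 8 = 1) ∧ (∀ p ∈ l.primeFactors, p % 4 = 1) := by
  constructor <;> intro p hp <;> rw [Nat.Prime.primeFactors hl, Finset.mem_singleton] at hp <;> subst hp <;> omega

/-- **Wang 2016 at `k = 1`, K-free.** Granted Wang's Thm 3 and Lemma 4 (named journal facts of the tree): for every prime `l ≡ 1 (mod 8)`,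
`l = u² + 8v²` with `v` odd ⟺ (`rank E_l(ℚ) = 0` and `Ш(E_l/ℚ)[2^∞] ≃ (ℤ/2)²`).  (The class-group binder `h₄(l) = 1` of Thm 3 is discharged by
Lemma 4 from `#Sel₂(E_l) = 16`, Monsky; the field binder by the tree's `sqrtField (−l)`.)
[cite: Wang2016CongruentSha, Thm. 3 (arXiv:1511.03810 p0011 L107–L131) and Lemma 4 (p0010 L20–L22)] -/
theorem isDeltaOne_iff_rank_zero_and_sha_of_wang (h3 : thm3_rank_zero_and_sha_two_by_two)
    (hL4 : lem4_card_selmerGroup_two_eq_sixteen_iff_h4) {l : ℕ} (hl : l.Prime) (h8 : l % 8 = 1) :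
    haveI := isElliptic_congruentNumberCurve hl.ne_zero
    IsDeltaOne l ↔
      ((congruentNumberCurve l).mordellWeilRank = 0 ∧
        Nonempty (AddCommGroup.primaryComponent (congruentNumberCurve l).sha 2 ≃+ (ZMod 2 × ZMod 2))) := by
  haveI := isElliptic_congruentNumberCurve hl.ne_zero
  haveI : Fact (-((l : ℕ) : ℤ) < 0) := ⟨by have := hl.pos; omega⟩
  have hK := isQuadraticFieldOfSqrt_sqrtField (-((l : ℕ) : ℤ))
  obtain ⟨h8', h4'⟩ := primeFactors_mod_of_prime hl h8
  have hS₂ := natCard_selmerGroup_two_prime_one_mod_eight hl h8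
  have h4 : Tian2014.fourTwoCard (ClassGroup (NumberField.RingOfIntegers (sqrtField (-((l : ℕ) : ℤ))))) = 2 :=
    (hL4 l hl.squarefree h8 h4' _ hK).mp (by rw [hS₂]; norm_num)
  have hW := (h3 l hl.squarefree h8' _ hK h4).2
  rw [odd_deltaCount_iff_isDeltaOne hl] at hW
  exact hW

/-- ★★★ **THE CENSUS LAW (L1) BY NAME.** Granted conjuncts 2 and 4 of 𝔅_ram and Wang 2016 (Thm 3 + Lemma 4): for every prime `l ≡ 1 (mod 8)`
with `ord_{s=1} L(E_l, s) = 0` and every integer `L` with `𝓛(l)² = L²`:  **`¬ 4 ∣ L ⟺ l = u² + 8v²` with `v` odd** (`IsDeltaOne l`; for a prime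
`l ≡ 1 (mod 8)` the representation by `x² + 8y²` is unique up to signs, so `¬ IsDeltaOne l ⟺ l = x² + 32y²`) — i.e. `2 ∥ 𝓛(l)` on Wang's
`δ = 1` primes and `4 ∣ 𝓛(l)` on the others: the line's census law (L1) «`4 ∣ 𝓛(l) ⟺ l = x² + 32y²`» (34/34 primes of the R2 census,
`Lines/offtyz_v7_GenusPeriodBit.md` §9–§11) on the `r_an(E_l) = 0` locus, as a kernel theorem modulo named journal facts.
[cite: Wang2016CongruentSha, Thm. 3 and Lemma 4] [cite: TianYuanZhang2017, §1 (1.1)] [cite: BurungaleFlach2024, Thm 1.1 / Cor. 3]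
[cite: HeathBrown1994SelmerCongruentII, Appendix (Monsky)] -/
theorem not_four_dvd_scriptL_iff_isDeltaOne_of_facts (hmod : WeierstrassCurve.hasEntireLFunction_rat)
    (hCM0 : bsdTriple_of_hasCM_of_L_one_ne_zero) (h3 : thm3_rank_zero_and_sha_two_by_two)
    (hL4 : lem4_card_selmerGroup_two_eq_sixteen_iff_h4) {l : ℕ} (hl : l.Prime) (h8 : l % 8 = 1)
    (h0 : (congruentNumberCurve l).analyticRank = 0) {L : ℤ} (hL : IsScriptL l L) :
    ¬ (4 : ℤ) ∣ L ↔ IsDeltaOne l := by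
  haveI := isElliptic_congruentNumberCurve hl.ne_zero
  haveI : Fact (Nat.Prime 2) := ⟨Nat.prime_two⟩
  have hsq := hl.squarefree
  obtain ⟨hL0, -, hiff⟩ := prime_one_mod_eight_digit_of_facts hmod hCM0 hl h8 h0 hL
  have hrk := mordellWeilRank_eq_zero_of_facts hmod hCM0 hsq h0
  obtain ⟨hfin, hcard⟩ := cardSha_eq_sq_of_facts hmod hCM0 hsq h0 hL
  haveI := hfin
  have hprim := natCard_primaryComponent_two_of_natCard_eq_sq (G := (congruentNumberCurve l).sha) hcard
  have hS₂ : Nat.card ((congruentNumberCurve l).selmerGroup 2) = 2 ^ (2 + 2) := by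
    rw [natCard_selmerGroup_two_prime_one_mod_eight hl h8]
  have hdigit := two_mul_padicValInt_eq_iff_selmerFour_of_facts hmod hCM0 hsq h0 hL hS₂
  rw [isDeltaOne_iff_rank_zero_and_sha_of_wang h3 hL4 hl h8]
  constructor
  · intro h4L
    have hS₄ : Nat.card ((congruentNumberCurve l).selmerGroup 4) = 2 ^ (2 + 2) := by
      by_contra hne
      exact h4L (hiff.mpr (by simpa using hne))
    refine ⟨hrk, ?_⟩
    have hpc := primaryComponent_sha_two_eq_of_natCard_selmerGroup hsq (u := 2)
      (by rw [hS₂, hrk]) (by rw [hS₄, hrk])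
    refine nonempty_addEquiv_prod_zmod_of_natCard_eq_sq 2 (fun g => ?_) hpc.2
    have hg : (g : (congruentNumberCurve l).sha) ∈ AddSubgroup.torsionBy (congruentNumberCurve l).sha (2 : ℤ) :=
      hpc.1 ▸ g.2
    have hg' : (2 : ℤ) • (g : (congruentNumberCurve l).sha) = 0 := by simpa using hg
    exact Subtype.ext (by
      rw [AddSubgroupClass.coe_nsmul, ZeroMemClass.coe_zero, ← natCast_zsmul]
      exact_mod_cast hg')
  · rintro ⟨-, ⟨e⟩⟩ h4L
    have hc4 : Nat.card (AddCommGroup.primaryComponent (congruentNumberCurve l).sha 2) = 2 ^ 2 := by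
      rw [Nat.card_congr e.toEquiv, Nat.card_prod, Nat.card_zmod]; norm_num
    rw [hprim] at hc4
    have hv : 2 * padicValInt 2 L = 2 := Nat.pow_right_injective le_rfl hc4
    exact hiff.mp h4L (by rw [hdigit.mpr hv])

/-- ★★★ **(L1) with 𝔅_ram VERBATIM plus Wang 2016.** Granted the bundle of crux 20509 and Wang's Thm 3 + Lemma 4: for every prime
`l ≡ 1 (mod 8)` with `r_an(E_l) = 0` and every `L` with `𝓛(l)² = L²`: `L ≠ 0`, `2 ∣ L`, and `¬ 4 ∣ L ⟺ IsDeltaOne l`.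
[cite: Wang2016CongruentSha, Thm. 3 and Lemma 4] [cite: TianYuanZhang2017, §1 (1.1), §3.1 recursion] [cite: BurungaleFlach2024, Thm 1.1 / Cor. 3] -/
theorem scriptL_prime_digit_of_bundle_of_wang
    (hB : (Literature.NumberTheory.EllipticCurves.rank_eq_analyticRank_of_analyticRank_le_one ∧ WeierstrassCurve.hasEntireLFunction_rat ∧ WeierstrassCurve.bsdRHS_eq_of_isIsogenous ∧ Literature.NumberTheory.EllipticCurves.bsdTriple_of_hasCM_of_L_one_ne_zero ∧ Literature.NumberTheory.EllipticCurves.TianYuanZhang2017.thm12_parity_of_scriptL' ∧ Literature.NumberTheory.EllipticCurves.Tian2014.thm13_rank_one_and_sha_odd ∧ Literature.NumberTheory.QuadraticFields.RedeiReichardt.redeiReichardt_fourTwoCard_classGroup ∧ Literature.NumberTheory.EllipticCurves.LiLiuTian2024.thm12_bsd_congruentNumberCurve ∧ Literature.NumberTheory.EllipticCurves.Monsky1990.cor515_rank_eq_one_and_card_selmerGroup_two ∧ Literature.NumberTheory.EllipticCurves.HeathBrown1994.monsky_card_selmerGroup_two_even ∧ Literature.NumberTheory.EllipticCurves.Ti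an2014.tian2014_system_sMinus_genus))
    (h3 : thm3_rank_zero_and_sha_two_by_two) (hL4 : lem4_card_selmerGroup_two_eq_sixteen_iff_h4)
    {l : ℕ} (hl : l.Prime) (h8 : l % 8 = 1) (h0 : (congruentNumberCurve l).analyticRank = 0) {L : ℤ} (hL : IsScriptL l L) :
    L ≠ 0 ∧ (2 : ℤ) ∣ L ∧ (¬ (4 : ℤ) ∣ L ↔ IsDeltaOne l) :=
  ⟨(prime_one_mod_eight_digit_of_facts hB.2.1 hB.2.2.2.1 hl h8 h0 hL).1,
    (prime_one_mod_eight_digit_of_facts hB.2.1 hB.2.2.2.1 hl h8 h0 hL).2.1,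
    not_four_dvd_scriptL_iff_isDeltaOne_of_facts hB.2.1 hB.2.2.2.1 h3 hL4 hl h8 h0 hL⟩

end Summit.BirchSwinnertonDyer.PrintCf2.RankZeroDigit

end
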